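import Summits.CriticalPhenomena.PercolationContinuityZ3.Theorems.PercAnnulusCrossingIICCondFatOfRobustUniq
import HarnessLib

/-!
# The volume exponent of Kesten's IIC in `ℤ^d` / `ℤ³` exists and equals `d − 1/ρ`, conditionally (lane RSW3, p1 gen 17)

builds on p205010 (kernel theorem, internal audit signed; external expert review pending) — NOT used in this file.

RSW3 lane (LANE 3 `prim-rsw3`), seat `prim-rsw3-p1` (gen 17).  Helper file (`--supports stmt-CriticalPhenomena-4575`); no definitions, no
sorries.  Memo `run/shared/lean/prim/rsw3/P1-QM.md` §30.  gen 15 proved, at `p_c(ℤ^d)` under (A2)□ and TIGHTNESS of the annulus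
crossing-cluster count at one aspect `C₀`, that `β⁺ + 1/ρ = d` whenever the one-arm exponent `1/ρ` exists
(`iicMeasure_mass_dimension_eq_of_tight_criticalProbI`); gen 17 (`…IICLowerMassDimensionZd`) proved `β⁻ + 1/ρ = d` under (A2)□ + `CU⁺_l` +
`UAD`.  Together: **the volume growth exponent of the IIC exists almost surely and equals `d − 1/ρ`** — the `ℤ^d` analogue of gen 16's planar
theorem `iicMeasure_ae_tendsto_volume_exponent_Z2`, conditionally on (A2)□(s,L) + `CU⁺_l` + `UAD` + count tightness (+ existence of `1/ρ`).

* **`iicMeasure_ae_tendsto_volume_exponent_Zd`** — `log V_n / log(n+2) → d − 1/ρ` `ν`-a.s., for every IIC-type probability measure `ν`;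
* **`iicMeasure_ae_tendsto_volume_exponent_Z3_of_robustCondAnnulusUniq_of_critAnnulusNonCrossing`** — on `ℤ³` from `CU⁺_l` + X_B + count
  tightness ((A2)□ at aspect `(l,l²)` and `UAD` being consequences).
References: H. Kesten, PTRF 73 (1986) Thm. (8); D. Basu, A. Sapozhnikov, ECP 22 (2017) Thm. 1.1; G. Kozma, A. Nachmias, JAMS 24 (2011) Lemma 3.1.
-/

noncomputable section

namespace Summit.CriticalPhenomena.PercolationContinuityZ3.Theorems.Crossing

open MeasureTheory Filter Topology Literature.Probability.Percolation Literature.Probability.LatticeModels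
open Literature.Probability.Percolation.DCT16
open Summit.CriticalPhenomena.PercolationContinuityZ3.Theses
open Summit.CriticalPhenomena.PercolationContinuityZ3.Theorems.SurfaceTension
open scoped ENNReal NNReal

variable {d : ℕ}

open Classical in
/-- **THE VOLUME EXPONENT OF KESTEN'S IIC IN `ℤ^d` EXISTS AND EQUALS `d − 1/ρ`** (`d ≥ 2`; at `p_c(ℤ^d)`: (A2)□ at aspect `(s,L)`, `CU⁺_l(c_U)`,
`UAD`, tightness of the annulus crossing-cluster count `N(n, C₀n)` at one `C₀ ≥ 2`, and existence of the one-arm exponent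
`(−log π(n))/log(n+2) → 1/ρ`): `1/ρ ≤ d` and for every IIC-type probability measure `ν`, `ν`-a.s.
**`log #{z ∈ Λ(n) : 0 ↔ z} / log(n+2) → d − 1/ρ`** (in `[0,∞]`).  (`β⁺ + 1/ρ = d` is gen 15 under tightness; `β⁻ + 1/ρ = d` is gen 17.)
[cite: Kesten1986, Thm. (8)] [cite: BasuSapozhnikov2017ECP, Thm. 1.1] [cite: KozmaNachmias2011, Lemma 3.1] -/
theorem iicMeasure_ae_tendsto_volume_exponent_Zd (hd : 2 ≤ d) {s L : ℕ} (hs : 2 ≤ s) (hsL : s ≤ L) {ϰ : ℝ} (hϰ : 0 < ϰ)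
    (hA2 : SetToSetQuasiMultAspectAt d (criticalProbI d) s L ϰ) {l : ℕ} (hl : 2 ≤ l) {cU : ℝ} (hcU : 0 < cU)
    (hCU : ∀ a : ℕ, 1 ≤ a → ∀ E : Set (BondConfig (Site d)), IsUpperSet E → MeasurableSet E →
      cU * (bondPercolation (zdGraph d) (criticalProbI d)).real E ≤ (bondPercolation (zdGraph d) (criticalProbI d)).real (E ∩
        {ω : BondConfig (Site d) | ∀ t ∈ innerBoundary (zdGraph d) (box d a), ∀ s ∈ innerBoundary (zdGraph d) (box d (l * a)),
          ∀ t' ∈ innerBoundary (zdGraph d) (box d a), ∀ s' ∈ innerBoundary (zdGraph d) (box d (l * a)),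
          ω ∈ openConnIn (↑((box d (l * a) \ box d a) ∪ innerBoundary (zdGraph d) (box d a)) : Set (Site d)) t s →
          ω ∈ openConnIn (↑((box d (l * a) \ box d a) ∪ innerBoundary (zdGraph d) (box d a)) : Set (Site d)) t' s' →
          ω ∈ openConnIn (↑((box d (l * a) \ box d a) ∪ innerBoundary (zdGraph d) (box d a)) : Set (Site d)) s s'}))
    (hUAD : ∀ ε : ℝ, 0 < ε → ∃ K₀ : ℕ, ∀ m : ℕ, 1 ≤ m → ∀ N : ℕ, K₀ * m ≤ N →
      (bondPercolation (zdGraph d) (criticalProbI d)).real (boxCrossing d m N) ≤ ε)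
    {C₀ : ℕ} (hC₀ : 2 ≤ C₀)
    (hT : ∀ ε : ℝ, 0 < ε → ∃ k : ℕ, ∀ n : ℕ, 1 ≤ n →
      (bondPercolation (zdGraph d) (criticalProbI d)).real {ω | (k : ℕ∞) < annulusClusterCount d n (C₀ * n) ω} ≤ ε)
    {ρinv : ℝ≥0∞}
    (hρ : Tendsto (fun n : ℕ => ENNReal.ofReal (-Real.log (oneArmProb d (criticalProbI d) n) / Real.log ((n : ℝ) + 2))) atTop (𝓝 ρinv))
    {ν : Measure (BondConfig (Site d))} [IsProbabilityMeasure ν]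
    (hν : ∀ (F : Finset (Sym2 (Site d))) (E : Set (BondConfig (Site d))), MeasurableSet E → DeterminedBy E ↑F →
      Tendsto (fun n : ℕ => (bondPercolation (zdGraph d) (criticalProbI d)).real (E ∩ siteToBoundary d n) /
        oneArmProb d (criticalProbI d) n) atTop (𝓝 (ν.real E))) :
    ρinv ≤ d ∧ ∀ᵐ ω ∂ν, Tendsto (fun n => ENNReal.ofReal
        (Real.log ((((box d n).filter fun z => ω ∈ (openConn (0 : Site d) z : Set (BondConfig (Site d)))).card : ℕ) : ℝ) /
          Real.log ((n : ℝ) + 2))) atTop (𝓝 ((d : ℝ≥0∞) - ρinv)) := by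
  obtain ⟨βl, βu, ⟨-, -, -, -, h5⟩, hae⟩ := iicMeasure_lower_mass_dimension_Zd hd hs hsL hϰ hA2 hl hcU hCU hUAD hν
  obtain ⟨βl', βu', ⟨-, -, hu'⟩, hae'⟩ := iicMeasure_mass_dimension_eq_of_tight_criticalProbI hd hs hsL hϰ hA2 hC₀ hT hρ hν
  have hlo : βl + ρinv = d := h5 ρinv hρ
  -- the two pairs of exponents are the same a.s. limits
  obtain ⟨ω, hω, hω'⟩ := (hae.and hae').exists
  have hβu : βu = βu' := hω.2.symm.trans hω'.2
  have hup : βu + ρinv = d := by rw [hβu]; exact hu'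
  have hρd : ρinv ≤ d := by rw [← hlo]; exact le_add_self
  have hρtop : ρinv ≠ ⊤ := ne_top_of_le_ne_top (ENNReal.natCast_ne_top d) hρd
  have hβl : βl = d - ρinv := ENNReal.eq_sub_of_add_eq hρtop hlo
  have hβu2 : βu = d - ρinv := ENNReal.eq_sub_of_add_eq hρtop hup
  refine ⟨hρd, hae.mono fun ω' hω' => ?_⟩
  rw [← hβl]
  exact tendsto_of_liminf_eq_limsup hω'.1 (hβl ▸ hβu2 ▸ hω'.2)

open Classical in
/-- **`ℤ³`: THE VOLUME EXPONENT OF KESTEN'S IIC EXISTS AND EQUALS `3 − 1/ρ`, FROM `CU⁺_l` + X_B + COUNT TIGHTNESS** (`l ≥ 2`, `c_U > 0`, `C₀ ≥ 2`;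
at `p_c(ℤ³)`; (A2)□ at aspect `(l, l²)` and `UAD` are consequences of `CU⁺_l` and X_B): if the one-arm exponent `1/ρ` exists then for every
IIC-type probability measure `ν`, `ν`-a.s. `log #{z ∈ Λ(n) : 0 ↔ z} / log(n+2) → 3 − 1/ρ`.
[cite: Kesten1986, Thm. (8)] [cite: BasuSapozhnikov2017ECP, Thm. 1.1] [cite: KozmaNachmias2011, Lemma 3.1] -/
theorem iicMeasure_ae_tendsto_volume_exponent_Z3_of_robustCondAnnulusUniq_of_critAnnulusNonCrossing {l : ℕ} (hl : 2 ≤ l)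
    {cU : ℝ} (hcU : 0 < cU)
    (hCU : ∀ a : ℕ, 1 ≤ a → ∀ E : Set (BondConfig (Site 3)), IsUpperSet E → MeasurableSet E →
      cU * (bondPercolation (zdGraph 3) (criticalProbI 3)).real E ≤ (bondPercolation (zdGraph 3) (criticalProbI 3)).real (E ∩
        {ω : BondConfig (Site 3) | ∀ t ∈ innerBoundary (zdGraph 3) (box 3 a), ∀ s ∈ innerBoundary (zdGraph 3) (box 3 (l * a)),
          ∀ t' ∈ innerBoundary (zdGraph 3) (box 3 a), ∀ s' ∈ innerBoundary (zdGraph 3) (box 3 (l * a)),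
          ω ∈ openConnIn (↑((box 3 (l * a) \ box 3 a) ∪ innerBoundary (zdGraph 3) (box 3 a)) : Set (Site 3)) t s →
          ω ∈ openConnIn (↑((box 3 (l * a) \ box 3 a) ∪ innerBoundary (zdGraph 3) (box 3 a)) : Set (Site 3)) t' s' →
          ω ∈ openConnIn (↑((box 3 (l * a) \ box 3 a) ∪ innerBoundary (zdGraph 3) (box 3 a)) : Set (Site 3)) s s'}))
    (hXB : PercAnnulusCrossing.CritAnnulusNonCrossing) {C₀ : ℕ} (hC₀ : 2 ≤ C₀)
    (hT : ∀ ε : ℝ, 0 < ε → ∃ k : ℕ, ∀ n : ℕ, 1 ≤ n →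
      (bondPercolation (zdGraph 3) (criticalProbI 3)).real {ω | (k : ℕ∞) < annulusClusterCount 3 n (C₀ * n) ω} ≤ ε)
    {ρinv : ℝ≥0∞}
    (hρ : Tendsto (fun n : ℕ => ENNReal.ofReal (-Real.log (oneArmProb 3 (criticalProbI 3) n) / Real.log ((n : ℝ) + 2))) atTop (𝓝 ρinv))
    {ν : Measure (BondConfig (Site 3))} [IsProbabilityMeasure ν]
    (hν : ∀ (F : Finset (Sym2 (Site 3))) (E : Set (BondConfig (Site 3))), MeasurableSet E → DeterminedBy E ↑F →
      Tendsto (fun n : ℕ => (bondPercolation (zdGraph 3) (criticalProbI 3)).real (E ∩ siteToBoundary 3 n) /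
        oneArmProb 3 (criticalProbI 3) n) atTop (𝓝 (ν.real E))) :
    ρinv ≤ 3 ∧ ∀ᵐ ω ∂ν, Tendsto (fun n => ENNReal.ofReal
        (Real.log ((((box 3 n).filter fun z => ω ∈ (openConn (0 : Site 3) z : Set (BondConfig (Site 3)))).card : ℕ) : ℝ) /
          Real.log ((n : ℝ) + 2))) atTop (𝓝 ((3 : ℝ≥0∞) - ρinv)) := by
  have hl0 : (0 : ℝ) < l := by exact_mod_cast (lt_of_lt_of_le (by norm_num) hl)
  have h := iicMeasure_ae_tendsto_volume_exponent_Zd (d := 3) (by norm_num) hl (Nat.le_mul_of_pos_left l (by omega))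
    (by positivity) (setToSetQuasiMultAspectAt_of_robustCondAnnulusUniq (d := 3) (by norm_num) hl hcU.le hCU) hl hcU hCU
    (uad_of_critAnnulusNonCrossing hXB) hC₀ hT hρ hν
  push_cast at h
  exact h

end Summit.CriticalPhenomena.PercolationContinuityZ3.Theorems.Crossing

end
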